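import Summits.BirchSwinnertonDyer.BirchSwinnertonDyer.Theorems.ByReductionTypeAtTwoOrdKatoHalfAtTwoIsoOmegaRoadDefs
import Summits.BirchSwinnertonDyer.BirchSwinnertonDyer.Theorems.ByReductionTypeAtTwoOrdKatoHalfAtTwoIsoKolyvaginPackageTwo
import Summits.BirchSwinnertonDyer.BirchSwinnertonDyer.Theorems.ByReductionTypeAtTwoOrdKatoHalfAtTwoIsoStepFourOfInl
import Summits.BirchSwinnertonDyer.BirchSwinnertonDyer.Theorems.ByReductionTypeAtTwoOrdKatoHalfAtTwoIsoPairTransportTransposition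
import Summits.BirchSwinnertonDyer.BirchSwinnertonDyer.Theorems.ByReductionTypeAtTwoOrdKatoHalfAtTwoIsoQTermTransposition
import Summits.BirchSwinnertonDyer.BirchSwinnertonDyer.Theorems.ByReductionTypeAtTwoOrdKatoHalfAtTwoIsoFrobeniusAtTwoAux
import Summits.BirchSwinnertonDyer.BirchSwinnertonDyer.Theorems.SmallImageMuTransferMuTransferX9StepsTwoFourAssembly
import Literature.NumberTheory.EllipticCurves.TwoDescentTwoTorsionCharacter
import HarnessLib

/-!
# Route ByReductionTypeAtTwo, crux `OrdKatoHalfAtTwoIso` (stmt-BirchSwinnertonDyer-19573), line `steinberg-fibre-at-two`,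
# registered stub `stub_HK_kolyvaginRankOneTwo : KolyvaginRankOneTwo` (Ω2 = H-K: Kolyvagin's class of ONE transposition prime
# and the reciprocity law at `p = 2`) — the ASSEMBLY

Seat `cruxlead-stmt-BirchSwinnertonDyer-19573-g0` (LEAD PROVER, MODE LINE; HOME `run/shared/lean/pub/bsd-2adic/`).
THEOREMS ONLY. HONEST FRAMING (cell bsd-2adic): BSD is not proved by any of this; the crux is not proved; this file
targets the REGISTERED research stub `stub_HK_kolyvaginRankOneTwo` of skeleton v7, i.e. the displayed statement
`SteinbergFibreAtTwo.KolyvaginRankOneTwo` (`Theorems/…OmegaRoadDefs.lean`, p658966). It is the `p = 2`, TRANSPOSITION-prime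
twin of the odd kernel's `StepsTwoFour.stub_stepsTwoFourOdd_of` (`…X9StepsTwoFourAssembly.lean:181–385`), assembling:
the `p = 2` Kolyvagin package `exists_kolyvaginPackage_two` (p664682: tame class H16₂ → value input → hp2-free Kolyvagin
cocycle → K3 value line), the wave-4 q-term identity at a transposition prime `exists_unit_qTermIdentity_transposition`,
Step 4 with the real-place vanishing at `Δ < 0` `StepFour.convCoeff_eq_zero_of_qTermIdentity_modPTwist_two` (p662576), and
the pair transport `StepsTwoFourTransport.exists_forall_convCoeff_aeval_frobSub_eq_zero_of_isAbsArithFrob` (p664102); the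
exact depth `d ≥ n` of the stub's Frobenius comes from `exists_depth_of_isArithFrobAt` (p661875, `κ` cyclotomic).

References: B. Mazur, K. Rubin, Mem. AMS 799 (2004) §1.2, Prop. 1.3.2, §3 [MazurRubin2004]; K. Rubin, *Euler Systems*
(2000) §4.4–4.5 [Rubin2000]; K. Kato, Astérisque 295 (2004) §13 [Kato2004Asterisque]; J. S. Milne, *Arithmetic Duality
Theorems* (2006) I Thm. 4.10 [MilneADT2006].
-/

set_option linter.dupNamespace false
set_option autoImplicit false

noncomputable section

open scoped NumberField ContRepresentation
open CategoryTheory Function Finset Polynomial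
open Field IsDedekindDomain NumberField
open Literature.NumberTheory.GaloisRepresentations
open Literature.NumberTheory.GaloisRepresentations.IsNonarchimedeanLocalField
open Literature.NumberTheory.GaloisCohomology
open Literature.NumberTheory.EllipticCurves
open Literature.NumberTheory.EllipticCurves.Kato2004
open Literature.NumberTheory.EllipticCurves.Kato2004.EulerSystemValues
open Rat.HeightOneSpectrum
open Summit.BirchSwinnertonDyer.Rank1Residual.GaloisImage
open Summit.BirchSwinnertonDyer.BirchSwinnertonDyer.Rank1Residual
open Summit.BirchSwinnertonDyer.BirchSwinnertonDyer.Rank1Residual.StepsTwoFour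

namespace Summit.BirchSwinnertonDyer.BirchSwinnertonDyer.Theorems.SteinbergFibreAtTwo

/-- The powers of the shift commute with the twisted action on `𝒯_J(E)` (`shiftEnd_twistModP_apply` iterated).
[cite: Washington1997, §13.1–§13.2] -/
theorem modPTwist_shiftEnd_pow_apply (W : WeierstrassCurve ℚ) (κ : ZpExtension ℚ 2) (J k : ℕ)
    (g : Field.absoluteGaloisGroup ℚ) (x : Fin J → WeierstrassCurve.geomTorsion W ((2 : ℕ) : ℤ)) :
    W.modPTwist 2 κ J g ((shiftEnd (WeierstrassCurve.geomTorsion W ((2 : ℕ) : ℤ)) J ^ k) x) =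
      (shiftEnd (WeierstrassCurve.geomTorsion W ((2 : ℕ) : ℤ)) J ^ k) (W.modPTwist 2 κ J g x) := by
  induction k generalizing x with
  | zero => simp
  | succ k ih =>
    rw [pow_succ', Module.End.mul_apply, Module.End.mul_apply, ← ih]
    exact (ZpExtension.shiftEnd_twistModP_apply κ _ _ J g _).symm

/-- **Registered stub Ω2 `stub_HK_kolyvaginRankOneTwo`: Kolyvagin's class of ONE transposition prime and the reciprocity
law at `p = 2`** (`KolyvaginRankOneTwo`). Proof = the odd kernel's Steps 3–4 assembly at `p = 2`: exceptional set = the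
package's `S₀` ∪ the bad set of `E[2]`; the stub's Frobenius `Fr ∈ Γ^{2ⁿ}` has an exact depth `d ≥ n` (`κ` cyclotomic,
`q ∤ 2`); the `p = 2` Kolyvagin package at `q` gives `κ_q = [c]`, `τq`, `r` and the VALUE
`c(res τq) = S^a((res r)·Φ(res r) − Φ(res r))`; the q-term identity at a transposition prime and Step 4 (Poitou–Tate,
`H¹(ℝ, 𝒯_J) = 0` from `Δ < 0`, `T^ε`-device on `S₁`, ur ⊥ ur off `S₁`) give `C_i(c(res τq), Ψc(res r)) = 0` for
`i + ε < J`; the pair transport carries the statement to `(𝔓, Fr)` with `Φ' = S^a ∘ Φ` unramified at `q`.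
[cite: MazurRubin2004, Prop. 1.3.2 and §3] [cite: Rubin2000, Thm. 4.5.4] [cite: MilneADT2006, Ch. I, Thm. 4.10] -/
theorem stub_HK_kolyvaginRankOneTwo : KolyvaginRankOneTwo := by
  intro W _ _ _ _ _ κ γ I hκ h2 hΔ hγ hPTfact s hES
  classical
  haveI : Fact (2 : ℕ).Prime := ⟨Nat.prime_two⟩
  haveI : Finite (WeierstrassCurve.geomTorsion W ((2 : ℕ) : ℤ)) := finite_geomTorsion_of_neZero W 2
  -- the package's exceptional set and the bad set of `E[2]`
  obtain ⟨S₀', hS₀'fin, hK⟩ := exists_kolyvaginPackage_two W κ hκ γ I h2 hES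
  obtain ⟨S₀'', hS₀''fin, hS₀''⟩ :=
    TorsionUnramified.exists_finite_isUnramifiedAt_torsionGaloisModule W (K := ℚ) (p := 2) two_ne_zero
  refine ⟨S₀' ∪ S₀'', hS₀'fin.union hS₀''fin, ?_⟩
  intro a κ' hκ' J n hJn Φ hΦ ε S₁ Ψ Ψc hS hΨc hΨur hΨS eW hμ hadd₁ hadd₂ halt hnd hgal q hq 𝔓 h𝔓 Fr hFr
    hT1 hT hFrn
  have hq' : q ∉ S₀' := fun h => hq (hS (Or.inl h))
  have hoff : ∀ v ∉ S₁, ((2 : ℕ) : 𝓞 ℚ) ∉ v.asIdeal ∧ W.HasGoodReductionAt v ∧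
      GaloisRep.IsUnramifiedAt v (W.torsionGaloisModule ((2 : ℕ) : ℤ)) :=
    fun v hv => hS₀'' v fun h => hv (hS (Or.inr h))
  obtain ⟨hqp, -, hur⟩ := hoff q hq
  -- the exact depth `d ≥ n` of `Fr`
  obtain ⟨d, hFrd, hFrd'⟩ := exists_depth_of_isArithFrobAt κ hκ hqp h𝔓 hFr
  have hnd' : n ≤ d := le_depth_of_mem_layerSubgroup κ hFrd' hFrn
  have hJd : J ≤ 2 ^ d := hJn.trans (Nat.pow_le_pow_right two_pos hnd')
  -- the prime `ℓ` of `q`, instances at `q`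
  haveI : NeZero ((primesEquiv q : Nat.Primes) : ℕ) := ⟨(primesEquiv q).2.ne_zero⟩
  haveI : Fact (((primesEquiv q : Nat.Primes) : ℕ)).Prime := ⟨(primesEquiv q).2⟩
  haveI : NeZero ((((primesEquiv q : Nat.Primes) : ℕ) : ℕ) : q.adicCompletion ℚ) := by
    haveI := charZero_adicCompletion q; exact NeZero.charZero
  haveI hN : (rootsOfUnityFixer ℚ ((primesEquiv q : Nat.Primes) : ℕ)).Normal :=
    KolyvaginTwist.normal_rootsOfUnityFixer _
  haveI : CompactSpace (absoluteGaloisGroup ℚ) := absoluteGaloisGroup_compactSpace ℚ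
  haveI : (rootsOfUnityFixer ℚ ((primesEquiv q : Nat.Primes) : ℕ)).FiniteIndex :=
    finiteIndex_of_isOpen_of_compactSpace _ (isOpen_rootsOfUnityFixer ℚ _)
  haveI : Fintype (absoluteGaloisGroup ℚ ⧸ rootsOfUnityFixer ℚ ((primesEquiv q : Nat.Primes) : ℕ)) :=
    Fintype.ofFinite _
  have hℓabs : Ideal.absNorm q.asIdeal = ((primesEquiv q : Nat.Primes) : ℕ) :=
    Literature.NumberTheory.LFunctions.absNorm_asIdeal_eq_primesEquiv q
  haveI : Fact (Ideal.absNorm q.asIdeal).Prime := ⟨by rw [hℓabs]; exact (primesEquiv q).2⟩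
  haveI : NeZero ((Ideal.absNorm q.asIdeal : ℕ) : q.adicCompletion ℚ) :=
    ⟨by rw [hℓabs]; exact NeZero.ne _⟩
  haveI : LocallyCompactSpace (absoluteGaloisGroup ℚ) := inferInstance
  haveI : CompactSpace (absoluteGaloisGroup (q.adicCompletion ℚ)) :=
    absoluteGaloisGroup_compactSpace (q.adicCompletion ℚ)
  haveI : LocallyCompactSpace (absoluteGaloisGroup (Place.Completion (Sum.inr q : Place ℚ))) :=
    (inferInstance : LocallyCompactSpace (absoluteGaloisGroup (q.adicCompletion ℚ)))
  -- the Kolyvagin package at `q`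
  obtain ⟨hI0, c, τq, r, hτq, hgen, hx, hr, hval⟩ :=
    hK a κ' hκ' d J hJd Φ hΦ q hq' 𝔓 h𝔓 Fr hFr hT hT1 hFrd hFrd'
  -- the local Frobenius `res r`: a transposition, in `Γ^{2ⁿ}`
  obtain ⟨hrr2, hrr1, hrrlayer⟩ :=
    LocalFrobenius.galoisRepTorsion_absGaloisRestrict_of_isArithFrobAt W κ hur hqp h𝔓 hFr hT hT1 hr
  have hrrn : absGaloisRestrict ℚ (q.adicCompletion ℚ) r ∈ κ.layerSubgroup n := (hrrlayer n).2 hFrn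
  -- `2 ∣ N(q) − 1`, `χ̄_{N q}` onto on inertia, `hgen` in the `absNorm` currency
  have hne : ((primesEquiv q : Nat.Primes) : ℕ) ≠ 2 := TameClass.primesEquiv_ne_of_natCast_not_mem hqp
  have hpl : 2 ∣ Ideal.absNorm q.asIdeal - 1 := by
    rw [hℓabs]
    obtain ⟨k, hk⟩ := ((primesEquiv q).2.eq_two_or_odd').resolve_left hne
    exact ⟨k, by omega⟩
  have hχI : ∀ u : (ZMod (Ideal.absNorm q.asIdeal))ˣ, ∃ t ∈ absInertia (q.adicCompletion ℚ),
      modPCyclotomicCharacterZMod (q.adicCompletion ℚ) (Ideal.absNorm q.asIdeal) t = u := fun u =>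
    Rat.exists_mem_absInertia_adicCompletion_modPCyclotomicCharacterZMod_eq_of_absNorm_eq q rfl u
  have hgen' : ∀ u : (ZMod (Ideal.absNorm q.asIdeal))ˣ,
      u ∈ Subgroup.zpowers (modPCyclotomicCharacterZMod (q.adicCompletion ℚ) (Ideal.absNorm q.asIdeal) τq) := by
    have key : ∀ (m : ℕ) [Fact m.Prime] [NeZero ((m : ℕ) : q.adicCompletion ℚ)],
        m = ((primesEquiv q : Nat.Primes) : ℕ) →
        ∀ u : (ZMod m)ˣ, u ∈ Subgroup.zpowers (modPCyclotomicCharacterZMod (q.adicCompletion ℚ) m τq) := by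
      intro m _ _ hm; subst hm; exact hgen
    exact key _ hℓabs
  -- the Weil pairing datum and the Poitou–Tate invariants
  have he := StepFour.weilPairingHom_torsionGaloisModule_smul W 2 eW hμ hadd₁ hadd₂ hgal
  obtain ⟨ι, v₀, w₀, hι, h1⟩ := exists_iota_weilPairingHom_eq_one W 2 eW hμ hadd₁ hadd₂ hnd
  obtain ⟨inv, hperf, hPT⟩ := hPTfact 2
  -- the Selmer-side clauses of `Ψ = [Ψc]`, and `c` unramified off `S₁ ∪ {q}`
  have hΨ : ∀ v ∉ S₁, galoisCohomology.localization (W.modPTwist 2 κ.invTwist J) (Sum.inr v) 1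
      (oneCocycleClass (W.modPTwist 2 κ.invTwist J).toTopRep Ψc) ∈
      DiscreteGaloisModule.unramifiedSubgroup (GaloisRep.toLocal v (W.modPTwist 2 κ.invTwist J)) 1 :=
    fun v hv => by rw [hΨc]; exact hΨur v hv
  have hΨS' : ∀ v ∈ S₁, galoisCohomology.localization (W.modPTwist 2 κ.invTwist J) (Sum.inr v) 1
      ((κ.invTwist.shiftH1 (W.torsionGaloisModule ((2 : ℕ) : ℤ))
        (fun P : WeierstrassCurve.geomTorsion W ((2 : ℕ) : ℤ) => AddSubgroup.torsionBy.nsmul P) J)^[ε]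
        (oneCocycleClass (W.modPTwist 2 κ.invTwist J).toTopRep Ψc)) = 0 := fun v hv => by
    rw [hΨc]; exact hΨS v hv
  have hxS : ∀ v ∉ S₁, v ≠ q → galoisCohomology.localization (W.modPTwist 2 κ J) (Sum.inr v) 1
      (oneCocycleClass (W.modPTwist 2 κ J).toTopRep c) ∈
      DiscreteGaloisModule.unramifiedSubgroup (GaloisRep.toLocal v (W.modPTwist 2 κ J)) 1 :=
    fun v hv hvq => hx v hvq (hoff v hv).1 (hoff v hv).2.2
  -- STEP 4 ⊕ the q-term identity at the transposition prime, at `(c, τq, r)`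
  have h4 : ∀ i, i + ε < J →
      convCoeff (weilPairingHom W 2 eW hμ hadd₁ hadd₂) J i
        (c.1 (absGaloisRestrict ℚ (q.adicCompletion ℚ) τq))
        (Ψc.1 (absGaloisRestrict ℚ (q.adicCompletion ℚ) r)) = 0 := by
    -- the q-term identity at the transposition prime (wave 4, M3) …
    obtain ⟨u, hu0, hu⟩ := exists_unit_qTermIdentity_transposition W κ J eW hμ hadd₁ hadd₂ halt hnd hgal q ι hι
      hur hqp hpl hχI hr hrr1 hrr2 hJn hrrn hτq hgen' inv hperf
    -- … fed to STEP 4 with the real place killed by `Δ < 0` (wave 4, M4)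
    exact StepFour.convCoeff_eq_zero_of_qTermIdentity_modPTwist_two W κ eW hμ hadd₁ hadd₂ hgal hΔ hPT J S₁ q hq
      (fun v hv => (hoff v hv).1) (fun v hv => (hoff v hv).2.2) c hxS Ψc hΨ ε hΨS' τq r
      (AddMonoidHom.id (ZMod 2)) ι hι u hu0 (fun k hk => hu c Ψc (hΨ q hq) ε k hk)
  -- the unramified avatar `Φ' = S^a ∘ Φ` of `(I.redTower s)_J`
  set Φ' := κ.shiftPowCocycle (W.torsionGaloisModule ((2 : ℕ) : ℤ))
    (fun P : WeierstrassCurve.geomTorsion W ((2 : ℕ) : ℤ) => AddSubgroup.torsionBy.nsmul P) J a Φ with hΦ'def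
  have hΦ'cl : oneCocycleClass (W.modPTwist 2 κ J).toTopRep Φ' = (I.redTower s).1 J := by
    change oneCocycleClass (κ.twistModP (W.torsionGaloisModule ((2 : ℕ) : ℤ))
      (fun P : WeierstrassCurve.geomTorsion W ((2 : ℕ) : ℤ) => AddSubgroup.torsionBy.nsmul P) J).toTopRep
      (κ.shiftPowCocycle (W.torsionGaloisModule ((2 : ℕ) : ℤ))
        (fun P : WeierstrassCurve.geomTorsion W ((2 : ℕ) : ℤ) => AddSubgroup.torsionBy.nsmul P) J a Φ) = _
    rw [← ZpExtension.shiftH1_iterate_oneCocycleClass, ← hκ', ZpExtension.towerShift_iterate_apply_coe]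
    exact congrArg _ hΦ
  have hΦ'I : ∀ i ∈ absInertia (q.adicCompletion ℚ), Φ'.1 (absGaloisRestrict ℚ (q.adicCompletion ℚ) i) = 0 :=
    fun i hi => StepFour.apply_absGaloisRestrict_eq_zero_of_localization_mem_unramified κ
      (W.torsionGaloisModule ((2 : ℕ) : ℤ)) (fun P => AddSubgroup.torsionBy.nsmul P) J q hur hqp Φ'
      (by rw [← hΦ'cl] at hI0; exact hI0) hi
  have hΨI : ∀ i ∈ absInertia (q.adicCompletion ℚ), Ψc.1 (absGaloisRestrict ℚ (q.adicCompletion ℚ) i) = 0 :=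
    fun i hi => StepFour.apply_absGaloisRestrict_eq_zero_of_localization_mem_unramified κ.invTwist
      (W.torsionGaloisModule ((2 : ℕ) : ℤ)) (fun P => AddSubgroup.torsionBy.nsmul P) J q hur hqp Ψc
      (hΨ q hq) hi
  -- `S^a` commutes with the twisted action: `(res r)·Φ'(res r) − Φ'(res r) = S^a((res r)·Φ(res r) − Φ(res r))`
  have hshift : ∀ (g : absoluteGaloisGroup ℚ),
      W.modPTwist 2 κ J g (Φ'.1 g) - Φ'.1 g =
        (shiftEnd (WeierstrassCurve.geomTorsion W ((2 : ℕ) : ℤ)) J ^ a) (W.modPTwist 2 κ J g (Φ.1 g) - Φ.1 g) := by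
    intro g
    rw [hΦ'def, ZpExtension.shiftPowCocycle_apply, map_sub, modPTwist_shiftEnd_pow_apply]
  -- the pair statement at the local Frobenius `r`, with `U = 1`, `m = 0`
  have hloc : ∃ U : ℤ[X], ¬ (2 : ℤ) ∣ U.coeff 0 ∧ ∀ i, i + ε < J →
      convCoeff (weilPairingHom W 2 eW hμ hadd₁ hadd₂) J i
        (aeval (shiftEnd (WeierstrassCurve.geomTorsion W (2 : ℤ)) J) U
          ((shiftEnd (WeierstrassCurve.geomTorsion W (2 : ℤ)) J ^ 0)
            (W.modPTwist 2 κ J (absGaloisRestrict ℚ (q.adicCompletion ℚ) r)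
                (Φ'.1 (absGaloisRestrict ℚ (q.adicCompletion ℚ) r)) -
              Φ'.1 (absGaloisRestrict ℚ (q.adicCompletion ℚ) r))))
        (Ψc.1 (absGaloisRestrict ℚ (q.adicCompletion ℚ) r)) = 0 := by
    refine ⟨1, by simp, fun i hi => ?_⟩
    rw [map_one, Module.End.one_apply, pow_zero, Module.End.one_apply, hshift, ← hval]
    exact h4 i hi
  -- equivariance of the Weil pairing in the `•` spelling, trivial action on `μ₂`, and the transport to `(𝔓, Fr)`
  have he' : ∀ (g : absoluteGaloisGroup ℚ) (m m' : WeierstrassCurve.geomTorsion W ((2 : ℕ) : ℤ)),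
      weilPairingHom W 2 eW hμ hadd₁ hadd₂ (g • m) (g • m') =
        DiscreteGaloisModule.mu ℚ 2 g (weilPairingHom W 2 eW hμ hadd₁ hadd₂ m m') := fun g m m' => by
    rw [← WeierstrassCurve.torsionGaloisModule_apply_apply, ← WeierstrassCurve.torsionGaloisModule_apply_apply]
    exact he g m m'
  have hP : ∀ (g : absoluteGaloisGroup ℚ) (z : DiscreteGaloisModule.MuCarrier ℚ 2),
      DiscreteGaloisModule.mu ℚ 2 g z = z := fun g z => WeierstrassCurve.mu_two_apply_eq g z
  obtain ⟨U', hU'0, hU'⟩ :=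
    StepsTwoFourTransport.exists_forall_convCoeff_aeval_frobSub_eq_zero_of_isAbsArithFrob W κ
      (DiscreteGaloisModule.mu ℚ 2) he' hP hJn Φ' Ψc hqp hur hΦ'I hΨI hr hloc h𝔓 hFr hT hFrn
  refine ⟨U', hU'0, fun i hi => ?_⟩
  have h := hU' i hi
  rw [pow_zero, Module.End.one_apply, hshift] at h
  exact h

end Summit.BirchSwinnertonDyer.BirchSwinnertonDyer.Theorems.SteinbergFibreAtTwo

end
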